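import Summits.CriticalPhenomena.SAWScalingLimit.Theorems.SAWDevelopingMapObservableToSLETypeLadderCarvedReductionConditioning
import Summits.CriticalPhenomena.SAWScalingLimit.Theorems.SAWDevelopingMapObservableToSLETypeLadderCarvedReductionTranslation
import Summits.CriticalPhenomena.SAWScalingLimit.Theorems.SAWDevelopingMapObservableToSLETypeLadderRotationSAW
import HarnessLib

/-!
# Crux `SAWDevelopingMap.ObservableToSLE` (stmt-CriticalPhenomena-10472), line `six-class-type-ladder`,
stub T2b `stub_carvedReduction` (= twin stub 5a4 of stmt-CriticalPhenomena-14005): piece (G5a),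
THE EXACT SANDWICH `Z_{Λ''} ≤ Z^{carved} ≤ Z_N` and the squeeze it gives

Landing target:
`Summits/CriticalPhenomena/SAWScalingLimit/Theorems/SAWDevelopingMapObservableToSLETypeLadderCarvedReductionSandwich.lean`
(`--supports stmt-CriticalPhenomena-10472`; registered sub-goal `stub_carvedReduction_sandwich`).

The squeeze clause (d) of the moving-carving package consumed by the landed assembly
(`…CarvedReductionAssembly`) asks for carved mass `P(⊆ Λ'') ≥ 1 − ε'` on a sub-family cell
`Λ''`.  Here it is reduced to a ratio of two Duminil-Copin–Smirnov partition functions of FIXED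
pinned vertex domains, the currency of ARL″ (`TwoPieceAdmRestrictionLimit`):

* `carvedWeight_univ_le_sum` — THE UPPER SANDWICH `Z^{carved} ≤ Z_N(s(u,pu), s(v,pv))` for every
  vertex set `N ∌ pu, pv` containing every `S`-avoiding walk of `Ω_δ` from `u` (an `S`-avoiding
  self-avoiding walk of `Ω_δ ≤ ℍ` IS a mid-edge self-avoiding walk of `N`; injection, no edge
  hypothesis);
* `div_le_carvedLaw_subfamily_real` — with the lower sandwich `P(⊆ Λ'') = Z_{Λ''}/Z` of
  `…CarvedReductionConditioning`: `Z_{Λ''}/Z_N ≤ P(⊆ Λ'')`;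
* `stub_carvedReduction_sandwich` — the same in the PINNED frame (lattice translation by `x`,
  `…CarvedReductionTranslation`): `Z_{Λ'}(a', b')/Z_{N'}(a', b') ≤ P(⊆ Λ'')` for the pinned inner
  and outer domains `Λ' ⊆ N'` translating onto `Λ'' ⊆ N`.

Sources: G. Lawler, O. Schramm, W. Werner, Proc. Sympos. Pure Math. 72 (2004) §3.4 (restriction
property of the SAW); H. Duminil-Copin, S. Smirnov, Ann. of Math. 175 (2012) §1–2.
-/

noncomputable section

open scoped BigOperators Topology NNReal ENNReal Classical BoundedContinuousFunction
open Filter Set MeasureTheory Metric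
open Literature.Probability.LatticeModels (HexVertex hexGraph hexCenter triZeta triEmbed Site polyline)
open Literature.Probability.RandomPlanarGeometry
open Literature.Probability.RandomPlanarGeometry.SAW

namespace Summit.CriticalPhenomena.SAWScalingLimit.Theorems.ObservableToSLE.TypeLadder

open Summit.CriticalPhenomena.SAWScalingLimit.Theorems.ObservableToSLER.BridgeGate

section Outer

variable {Ω : Set ℂ} {δ : ℝ} {S : Set HexVertex} {N : Finset HexVertex} {u v pu pv : HexVertex}

variable (hN : ∀ (w : HexVertex) (π : (hexDomainGraph Ω δ).Walk u w),
    (∀ x ∈ π.support, x ∉ S) → ∀ x ∈ π.support, x ∈ N)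
  (huN : u ∈ N) (hpuN : pu ∉ N) (hpvN : pv ∉ N) (hadj : hexGraph.Adj u pu) (hne : s(u, pu) ≠ s(v, pv))

include hN huN hpuN hpvN hadj hne

/-- **THE UPPER SANDWICH `Z^{carved} ≤ Z_N`.**  If every `S`-avoiding walk of `Ω_δ` from `u` stays
in the vertex set `N` (`N ∋ u`, `N ∌ pu, pv`, `u ∼ pu`, distinct gate mid-edges), the total carved
weight is at most the Duminil-Copin–Smirnov partition function of `(N; s(u,pu), s(v,pv))`. -/
theorem carvedWeight_univ_le_sum [Fintype (HexDomainSAW Ω δ u v)] :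
    carvedWeight Ω δ S u v Set.univ ≤
      ∑ γ : HexMidEdgeSAW N s(u, pu) s(v, pv), ENNReal.ofReal (hexCriticalFugacity ^ γ.length) := by
  obtain ⟨e, he⟩ := ObservableToSLE.FloorRatio.exists_equiv_isPath_hexMidEdgeSAW (Λ := N) (vb := v)
    huN hpuN hpvN hadj hne
  -- the injection of `S`-avoiding walks of `Ω_δ` into mid-edge walks of `N`
  let ι : {ξ : HexDomainSAW Ω δ u v // ∀ x ∈ ξ.walk.support, x ∉ S} →
      HexMidEdgeSAW N s(u, pu) s(v, pv) := fun ξ =>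
    e ⟨ξ.1.walk.mapLe (embDomainGraph_le hexGraph hexCenter Ω δ),
      (SimpleGraph.Walk.isPath_mapLe _).2 ξ.1.isPath, by
        rw [SimpleGraph.Walk.support_mapLe_eq_support]; exact hN v ξ.1.walk ξ.2⟩
  have hιverts : ∀ ξ, (ι ξ).verts = ξ.1.walk.support := fun ξ => by
    simp only [ι, he, SimpleGraph.Walk.support_mapLe_eq_support]
  have hι : Function.Injective ι := by
    intro ξ₁ ξ₂ h
    have h' := congrArg HexMidEdgeSAW.verts h
    rw [hιverts, hιverts] at h'
    exact Subtype.ext (embDomainSAW_walk_injective (SimpleGraph.Walk.ext_support h'))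
  -- the carved weight as a sum over the subtype
  rw [carvedWeight, Measure.restrict_apply MeasurableSet.univ, Set.univ_inter,
    ObservableToSLE.FloorRatio.embWeight_apply_eq_sum]
  have hterm : ∀ ξ : {ξ : HexDomainSAW Ω δ u v // ∀ x ∈ ξ.walk.support, x ∉ S},
      ENNReal.ofReal (hexCriticalFugacity ^ ξ.1.vertexCount) =
        ENNReal.ofReal (hexCriticalFugacity ^ (ι ξ).length) := fun ξ => by
    rw [HexMidEdgeSAW.length, hιverts, SimpleGraph.Walk.length_support]
    rfl
  have key : (∑ γ ∈ Finset.univ.filter (fun γ : HexDomainSAW Ω δ u v => ∀ x ∈ γ.walk.support, x ∉ S),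
      ENNReal.ofReal (hexCriticalFugacity ^ γ.vertexCount)) ≤
      ∑ γ : HexMidEdgeSAW N s(u, pu) s(v, pv), ENNReal.ofReal (hexCriticalFugacity ^ γ.length) := by
    rw [Finset.sum_subtype (p := fun ξ : HexDomainSAW Ω δ u v => ∀ x ∈ ξ.walk.support, x ∉ S)
      (Finset.univ.filter (fun γ : HexDomainSAW Ω δ u v => ∀ x ∈ γ.walk.support, x ∉ S))
      (fun ξ => by simp only [Finset.mem_filter, Finset.mem_univ, true_and])
      (fun γ => ENNReal.ofReal (hexCriticalFugacity ^ γ.vertexCount))]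
    calc ∑ ξ : {ξ : HexDomainSAW Ω δ u v // ∀ x ∈ ξ.walk.support, x ∉ S},
          ENNReal.ofReal (hexCriticalFugacity ^ ξ.1.vertexCount)
        = ∑ ξ : {ξ : HexDomainSAW Ω δ u v // ∀ x ∈ ξ.walk.support, x ∉ S},
            ENNReal.ofReal (hexCriticalFugacity ^ (ι ξ).length) := Finset.sum_congr rfl fun ξ _ => hterm ξ
      _ = ∑ γ ∈ (Finset.univ.map ⟨ι, hι⟩), ENNReal.ofReal (hexCriticalFugacity ^ γ.length) := by
            rw [Finset.sum_map]; rfl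
      _ ≤ ∑ γ : HexMidEdgeSAW N s(u, pu) s(v, pv), ENNReal.ofReal (hexCriticalFugacity ^ γ.length) :=
            Finset.sum_le_sum_of_subset (Finset.subset_univ _)
  convert key using 3
  simp only [Set.mem_setOf_eq]

end Outer

section Squeeze

variable {Ω : Set ℂ} {δ : ℝ} {S : Set HexVertex} {Λ'' N : Finset HexVertex} {u v pu pv : HexVertex}

/-- **The squeeze from the sandwich**: on a sub-family cell `Λ''` of a probability carved law and
an outer vertex set `N` as in `carvedWeight_univ_le_sum`,
`Z_{Λ''}(s(u,pu), s(v,pv)) / Z_N(s(u,pu), s(v,pv)) ≤ P(⊆ Λ'')`. -/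
theorem div_le_carvedLaw_subfamily_real [Fintype (HexDomainSAW Ω δ u v)]
    [IsProbabilityMeasure (carvedLaw Ω δ S u v)]
    (hΛ''S : ∀ w ∈ Λ'', w ∉ S)
    (hedge : ∀ w ∈ Λ'', ∀ y ∈ Λ'', hexGraph.Adj w y → (hexDomainGraph Ω δ).Adj w y)
    (hu : u ∈ Λ'') (hpu : pu ∈ S) (hpv : pv ∈ S) (hadj : hexGraph.Adj u pu) (hne : s(u, pu) ≠ s(v, pv))
    (hN : ∀ (w : HexVertex) (π : (hexDomainGraph Ω δ).Walk u w),
      (∀ x ∈ π.support, x ∉ S) → ∀ x ∈ π.support, x ∈ N)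
    (huN : u ∈ N) (hpuN : pu ∉ N) (hpvN : pv ∉ N) :
    (∑ γ : HexMidEdgeSAW Λ'' s(u, pu) s(v, pv), hexCriticalFugacity ^ γ.length) /
        (∑ γ : HexMidEdgeSAW N s(u, pu) s(v, pv), hexCriticalFugacity ^ γ.length) ≤
      (carvedLaw Ω δ S u v {ξ | ∀ w ∈ ξ.walk.support, w ∈ Λ''}).toReal := by
  have hx : ∀ n : ℕ, 0 ≤ hexCriticalFugacity ^ n := fun n =>
    pow_nonneg hexCriticalFugacity_pos_lt_one.1.le n
  set Z := carvedWeight Ω δ S u v Set.univ with hZ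
  set ZΛ := ∑ γ : HexMidEdgeSAW Λ'' s(u, pu) s(v, pv), hexCriticalFugacity ^ γ.length with hZΛ
  set ZN := ∑ γ : HexMidEdgeSAW N s(u, pu) s(v, pv), hexCriticalFugacity ^ γ.length with hZN
  have hZΛ0 : 0 ≤ ZΛ := Finset.sum_nonneg fun _ _ => hx _
  have hZN0 : 0 ≤ ZN := Finset.sum_nonneg fun _ _ => hx _
  have hZ0 : Z ≠ 0 := by
    intro h0
    have h1 : carvedLaw Ω δ S u v Set.univ = 1 := measure_univ
    rw [carvedLaw, Measure.smul_apply, smul_eq_mul, ← hZ, h0, mul_zero] at h1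
    exact zero_ne_one h1
  have hZtop : Z ≠ ∞ := by
    intro ht
    have h1 : carvedLaw Ω δ S u v Set.univ = 1 := measure_univ
    rw [carvedLaw, Measure.smul_apply, smul_eq_mul, ← hZ, ht, ENNReal.inv_top, zero_mul] at h1
    exact zero_ne_one h1
  -- `Z ≤ Z_N`
  have hup : Z.toReal ≤ ZN := by
    have h := carvedWeight_univ_le_sum (S := S) hN huN hpuN hpvN hadj hne
    rw [← ENNReal.ofReal_sum_of_nonneg (fun _ _ => hx _)] at h
    exact ENNReal.toReal_le_of_le_ofReal hZN0 h
  have hZpos : 0 < Z.toReal := ENNReal.toReal_pos hZ0 hZtop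
  -- `P(⊆ Λ'') = Z_{Λ''} / Z`
  rw [carvedLaw_subfamily_real hΛ''S hedge hu hpu hpv hadj hne, ENNReal.toReal_inv]
  rcases eq_or_lt_of_le hZN0 with hZN' | hZNpos
  · rw [← hZN', div_zero]
    exact mul_nonneg (inv_nonneg.2 hZpos.le) hZΛ0
  · rw [div_eq_inv_mul]
    exact mul_le_mul_of_nonneg_right ((inv_le_inv₀ hZNpos hZpos).2 hup) hZΛ0

/-- **Registered sub-goal `stub_carvedReduction_sandwich`** (crux item stmt-CriticalPhenomena-10472,
stub T2b `stub_carvedReduction`, piece (G5a) EXACT SANDWICH + SQUEEZE, PINNED FRAME): for a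
sub-family cell `Λ''` and an outer vertex set `N` of a probability carved law which are the
lattice translates by `x` of pinned vertex domains `Λ' ⊆ N'` with pinned gate mid-edges `a', b'`,
`Z_{Λ'}(a', b') / Z_{N'}(a', b') ≤ P(⊆ Λ'')`.  (So clause (d) of the moving-carving squeeze follows
from `Z_{Λ'(δ_j)}/Z_{N'(δ_j)} → ≥ 1 − ε'`: ARL″ twice in a common super-domain.) -/
theorem stub_carvedReduction_sandwich :
    ∀ (Ω : Set ℂ) (δ : ℝ) (S : Set HexVertex) (Λ'' N Λ' N' : Finset HexVertex) (u v pu pv : HexVertex)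
      (x : Site 2) (a' b' : Sym2 HexVertex),
      Finite (HexDomainSAW Ω δ u v) → IsProbabilityMeasure (carvedLaw Ω δ S u v) →
      (∀ w ∈ Λ'', w ∉ S) → (∀ w ∈ Λ'', ∀ y ∈ Λ'', hexGraph.Adj w y → (hexDomainGraph Ω δ).Adj w y) →
      u ∈ Λ'' → pu ∈ S → pv ∈ S → hexGraph.Adj u pu → s(u, pu) ≠ s(v, pv) →
      (∀ (w : HexVertex) (π : (hexDomainGraph Ω δ).Walk u w),
        (∀ y ∈ π.support, y ∉ S) → ∀ y ∈ π.support, y ∈ N) →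
      u ∈ N → pu ∉ N → pv ∉ N →
      (∀ w : HexVertex, w ∈ Λ'' ↔ ((-x + w.1, w.2) : HexVertex) ∈ Λ') →
      (∀ w : HexVertex, w ∈ N ↔ ((-x + w.1, w.2) : HexVertex) ∈ N') →
      a'.map (fun w : HexVertex => ((x + w.1, w.2) : HexVertex)) = s(u, pu) →
      b'.map (fun w : HexVertex => ((x + w.1, w.2) : HexVertex)) = s(v, pv) →
      (∑ γ : HexMidEdgeSAW Λ' a' b', hexCriticalFugacity ^ γ.length) /
          (∑ γ : HexMidEdgeSAW N' a' b', hexCriticalFugacity ^ γ.length) ≤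
        (carvedLaw Ω δ S u v {ξ | ∀ w ∈ ξ.walk.support, w ∈ Λ''}).toReal := by
  intro Ω δ S Λ'' N Λ' N' u v pu pv x a' b' hfin hP hΛ''S hedge hu hpu hpv hadj hne hN huN hpuN hpvN
    hrel hrelN ha hb
  haveI := hfin
  haveI := Fintype.ofFinite (HexDomainSAW Ω δ u v)
  have h := div_le_carvedLaw_subfamily_real hΛ''S hedge hu hpu hpv hadj hne hN huN hpuN hpvN
  have hΛ := sum_hexMidEdgeSAW_translate x hrel a' b' (fun l => hexCriticalFugacity ^ l.length)
  have hNs := sum_hexMidEdgeSAW_translate x hrelN a' b' (fun l => hexCriticalFugacity ^ l.length)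
  rw [ha, hb] at hΛ hNs
  simp only [List.length_map] at hΛ hNs
  have e1 : (∑ γ : HexMidEdgeSAW Λ' a' b', hexCriticalFugacity ^ γ.length) =
      ∑ γ : HexMidEdgeSAW Λ'' s(u, pu) s(v, pv), hexCriticalFugacity ^ γ.length := hΛ.symm
  have e2 : (∑ γ : HexMidEdgeSAW N' a' b', hexCriticalFugacity ^ γ.length) =
      ∑ γ : HexMidEdgeSAW N s(u, pu) s(v, pv), hexCriticalFugacity ^ γ.length := hNs.symm
  rw [e1, e2]
  exact h

end Squeeze


end Summit.CriticalPhenomena.SAWScalingLimit.Theorems.ObservableToSLE.TypeLadder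

end
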